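import Summits.SmoothPoincare4.SmoothPoincare4.Theorems.SymplecticOrigamiOrigamiFoldExistenceStubOuterCleanRecognitionChartCutExterior

/-!
# Stub `stub_outerCleanRecognitionOfSide` of line `shadow-pleats` for crux `OrigamiFoldExistence` — P1:
# the LIFTED CUT REGION `U_R = chimney ∪ λG({2 ≤ ‖u‖ < R})` (item stmt-SmoothPoincare4-7844, route SymplecticOrigami; seat c5)

For a `1`-chart pleated position `(ι, δ, e)` with tube data `D` of its lifted outer crease
`C' = λG(S(0,2))` (chart shadow `G = proj5 ∘ ι ∘ e 0`, lift `λ = liftS4`; the two sides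
`chimney D` and `exterior D ∋ N` of file A `…ChartChimney`) and collar data `cd : CollarData D`
(file F `…ChartSide`: a thin collar of width `κ = cd.h.κ` on which `G` is immersive,
`cd.immersive`, and injective, `cd.injOn`, lifted into the exterior, `cd.mem_exterior`, with
local surjectivity onto the exterior side of the tube up to the height `cd.t₀ ≤ 1/4`,
`cd.localSurj`), the CUT REGION of radius `R` is

* `liftedCut D R = chimney D ∪ λG({2 ≤ ‖u‖ < R})`,

the open set `U` of the glue `nonempty_diffeomorph_of_chartComplement` in the cut-at-`R`
construction of S4''σ (`2 + κ/2 < R < 2 + κ`; its complement is what the structure map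
parametrises).  This file proves its five registered properties:

* `compl_liftedCut` — `(U_R)ᶜ = exterior D ∖ λG({2 < ‖u‖ < R})`: set algebra over the
  partition `S⁴ = chimney ⊔ C' ⊔ exterior` of file A (`mem_chimney_or`, `sideσ_eq_zero_iff`,
  `range_liftedCrease`);
* `isOpen_liftedCut` — `U_R` is open: it is the union of the chimney, of the lifted OPEN cut
  collar `λG({2 < ‖u‖ < R})` (open by the inverse function theorem for `G` on the collar,
  `isOpen_image_of_injOn_fderiv` of `…ChartShells`, and `isOpenMap_liftS4` of file P2
  `…ChartCutExterior`), and of the open tube of height `cd.t₀` around `C'`, whose chimney half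
  is chimney and whose closed exterior half consists of lifted shadows of collar points of radius
  `≤ 2 + κ/2 < R` (`cd.localSurj`, sides read off by `sideσ_tube`);
* `isConnected_liftedCut` — `U_R` is connected: the chimney is (`isConnected_chimney`), the
  lifted half-open collar is the continuous image of the connected shell `{2 ≤ ‖u‖ < R}`
  (`isPreconnected_icoShell`), and the two meet along `C' ⊆ closure (chimney D)` (bark and tree);
* `compl_closure_liftedCut` — `(closure U_R)ᶜ = exterior D ∖ λG({2 < ‖u‖ ≤ R})` (the closure
  of the lifted half-open collar is the compact lifted closed collar, `closure_image_icoShell`),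
  the set file P2 proves connected (`isConnected_exterior_diff_cutCollar`);
* `frontier_liftedCut` — `frontier U_R = λG(S_R)` (from the two complements, by thin-collar
  injectivity `cd.injOn` and `liftS4_injective`).
-/

noncomputable section

-- the prescribed namespace `Summit.<P>.<Sub>.…` duplicates `SmoothPoincare4` (P = Sub)
set_option linter.dupNamespace false

open scoped Manifold ContDiff Topology RealInnerProductSpace
open Set Function Filter Metric
open Literature.Topology.FourManifolds Literature.Topology.FourManifolds.SphereHypersurfaceSides

namespace Summit.SmoothPoincare4.SmoothPoincare4.Theorems.OrigamiFoldExistence.ShadowPleats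

/-! ### Two elementary facts about half-open shells of `ℝ⁴` -/

/-- The half-open shell `{a ≤ ‖u‖ < b}` of `ℝ⁴` (`a > 0`) is preconnected: it is the image of
`sphere × [a, b)` under `(x, r) ↦ r • x`. -/
-- adapted from `isPreconnected_openShell` (…StubCleanOnePleatIroningSigns): `Ioo` ↦ `Ico`
theorem isPreconnected_icoShell {a b : ℝ} (ha : 0 < a) :
    IsPreconnected {u : EuclideanSpace ℝ (Fin 4) | a ≤ ‖u‖ ∧ ‖u‖ < b} := by
  have himage : {u : EuclideanSpace ℝ (Fin 4) | a ≤ ‖u‖ ∧ ‖u‖ < b} =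
      (fun p : EuclideanSpace ℝ (Fin 4) × ℝ => p.2 • p.1) ''
        (sphere (0 : EuclideanSpace ℝ (Fin 4)) 1 ×ˢ Ico a b) := by
    ext x
    simp only [mem_setOf_eq, mem_image, mem_prod, mem_sphere_zero_iff_norm, mem_Ico, Prod.exists]
    constructor
    · rintro ⟨ha', hb'⟩
      have hx0 : 0 < ‖x‖ := ha.trans_le ha'
      refine ⟨‖x‖⁻¹ • x, ‖x‖, ⟨?_, ha', hb'⟩, ?_⟩
      · rw [norm_smul, norm_inv, norm_norm, inv_mul_cancel₀ hx0.ne']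
      · rw [smul_smul, mul_inv_cancel₀ hx0.ne', one_smul]
    · rintro ⟨y, r, ⟨hy, har, hrb⟩, rfl⟩
      have hr : 0 < r := ha.trans_le har
      rw [norm_smul, Real.norm_of_nonneg hr.le, hy, mul_one]
      exact ⟨har, hrb⟩
  rw [himage]
  have hE : 1 < Module.rank ℝ (EuclideanSpace ℝ (Fin 4)) :=
    Module.one_lt_rank_of_one_lt_finrank (by rw [finrank_euclideanSpace_fin]; norm_num)
  exact ((isPreconnected_sphere hE 0 1).prod isPreconnected_Ico).image _
    (continuous_snd.smul continuous_fst).continuousOn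

/-- For `2 < R` the sphere `S_R` lies in the closure of the half-open shell `{2 ≤ ‖u‖ < R}`
(`S_R ⊆ closure (ball 0 R)` and `{2 < ‖u‖}` is an open neighbourhood of `S_R`). -/
theorem mem_closure_icoShell {R : ℝ} (hR : 2 < R) {u : EuclideanSpace ℝ (Fin 4)} (hu : ‖u‖ = R) :
    u ∈ closure {v : EuclideanSpace ℝ (Fin 4) | 2 ≤ ‖v‖ ∧ ‖v‖ < R} := by
  have h1 : u ∈ closure (ball (0 : EuclideanSpace ℝ (Fin 4)) R) := by
    rw [closure_ball (0 : EuclideanSpace ℝ (Fin 4)) (by linarith : R ≠ 0), mem_closedBall_zero_iff, hu]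
  have h2 : u ∈ (closedBall (0 : EuclideanSpace ℝ (Fin 4)) 2)ᶜ := by
    rw [mem_compl_iff, mem_closedBall_zero_iff, not_le, hu]; exact hR
  refine closure_mono ?_ (isClosed_closedBall.isOpen_compl.inter_closure ⟨h2, h1⟩)
  rintro v ⟨hv2, hvR⟩
  rw [mem_compl_iff, mem_closedBall_zero_iff, not_le] at hv2
  exact ⟨hv2.le, mem_ball_zero_iff.1 hvR⟩

section CutRegion

variable {M : Type} [TopologicalSpace M] [ChartedSpace (EuclideanSpace ℝ (Fin 4)) M]
  {ι : M → EuclideanSpace ℝ (Fin 5)} {δ : ℝ} {e : Fin 1 → EuclideanSpace ℝ (Fin 4) → M}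

/-- THE LIFTED CUT REGION of radius `R`: the chimney of the lifted outer crease together with the lifted shadow of the
half-open cut collar `{2 ≤ ‖u‖ < R}` of the chart (for `R` inside the thin fold-free collar its frontier is the lifted
EMBEDDED sphere `λG(S_R)`, across which the structure map is a local diffeomorphism). -/
def liftedCut (D : TubeData (liftedCrease ι (e 0))) (R : ℝ) : Set (Metric.sphere (0 : EuclideanSpace ℝ (Fin 5)) 1) :=
  chimney D ∪ (liftS4 ∘ proj5 ∘ ι ∘ e 0) '' {u | 2 ≤ ‖u‖ ∧ ‖u‖ < R}

variable {D : TubeData (liftedCrease ι (e 0))}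

omit [TopologicalSpace M] [ChartedSpace (EuclideanSpace ℝ (Fin 4)) M] in
/-- **The complement of the cut region** is the exterior minus the lifted open cut collar. [folklore] -/
theorem compl_liftedCut (cd : CollarData D) {R : ℝ} (hR : 2 + cd.h.κ / 2 < R) :
    (liftedCut D R)ᶜ = exterior D \ (liftS4 ∘ proj5 ∘ ι ∘ e 0) '' {u | 2 < ‖u‖ ∧ ‖u‖ < R} := by
  have hN : northPole ∉ range (liftedCrease ι (e 0)) := northPole_notMem_range_liftedCrease ι (e 0)
  have hR2 : 2 < R := by linarith [cd.h.pos]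
  ext z
  rw [liftedCut, mem_compl_iff, mem_union, not_or, Set.mem_sdiff]
  constructor
  · rintro ⟨hzc, hzA⟩
    rcases mem_chimney_or D z with hz | hz | hz
    · exact absurd hz hzc
    · -- a crease point is a lifted shadow of radius `2 < R`
      obtain ⟨u, hu, rfl⟩ : z ∈ (liftS4 ∘ proj5 ∘ ι ∘ e 0) '' Metric.sphere 0 2 := by
        rw [← range_liftedCrease]
        exact (sideσ_eq_zero_iff D hN z).1 hz
      have hu2 : ‖u‖ = 2 := mem_sphere_zero_iff_norm.1 hu
      exact absurd ⟨u, ⟨hu2.symm.le, by rw [hu2]; exact hR2⟩, rfl⟩ hzA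
    · exact ⟨hz, fun ⟨u, hu, huz⟩ => hzA ⟨u, ⟨hu.1.le, hu.2⟩, huz⟩⟩
  · rintro ⟨hzE, hzA⟩
    refine ⟨fun hzc => Set.disjoint_left.1 (disjoint_chimney_exterior D) hzc hzE, ?_⟩
    rintro ⟨u, hu, rfl⟩
    rcases hu.1.lt_or_eq with hlt | heq
    · exact hzA ⟨u, ⟨hlt, hu.2⟩, rfl⟩
    · -- a lifted shadow of radius `2` is a crease point, not exterior
      refine Set.disjoint_left.1 (disjoint_exterior_range D hN) hzE ?_
      rw [range_liftedCrease]
      exact ⟨u, mem_sphere_zero_iff_norm.2 heq.symm, rfl⟩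

omit [TopologicalSpace M] [ChartedSpace (EuclideanSpace ℝ (Fin 4)) M] in
/-- The open tube of height `cd.t₀` around the lifted crease lies in the cut region as soon as
`2 + κ/2 < R`: its chimney half trivially, its core and its exterior half because every tube
point of pole-signed height in `[0, t₀]` is the lifted shadow of a collar point of radius
`≤ 2 + κ/2` (local surjectivity `cd.localSurj`). -/
theorem image_tube_subset_liftedCut (cd : CollarData D) {R : ℝ} (hR : 2 + cd.h.κ / 2 < R) :
    D.τ '' (univ ×ˢ {w : EuclideanSpace ℝ (Fin 1) | |w 0| < cd.t₀}) ⊆ liftedCut D R := by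
  have hN : northPole ∉ range (liftedCrease ι (e 0)) := northPole_notMem_range_liftedCrease ι (e 0)
  rintro _ ⟨⟨x, w⟩, ⟨-, hw⟩, rfl⟩
  have hw' : |w 0| < cd.t₀ := hw
  have hwle : |w 0| ≤ 1 / 4 := hw'.le.trans cd.t₀_le
  rcases lt_or_ge (poleSign D * w 0) 0 with hneg | hnonneg
  · -- the chimney half of the tube
    left
    show sideσ D (D.τ (x, w)) < 0
    rwa [sideσ_tube D x w hwle]
  · -- the core and the exterior half: lifted shadows of collar points of radius `≤ 2 + κ/2 < R`
    have hle : poleSign D * w 0 ≤ cd.t₀ := by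
      rcases poleSign_eq_or D hN with hs | hs
      · rw [hs, one_mul]; exact (le_abs_self _).trans hw'.le
      · rw [hs, neg_one_mul]; exact (neg_le_abs _).trans hw'.le
    obtain ⟨u, hu2, huκ, hGu⟩ := cd.localSurj x (w 0) hnonneg hle
    right
    refine ⟨u, ⟨hu2, by linarith⟩, ?_⟩
    show liftS4 ((proj5 ∘ ι ∘ e 0) u) = D.τ (x, w)
    rw [hGu, smul_e₀_eq]

/-- **The cut region is open** (`R` inside the thin collar). [folklore] -/
theorem isOpen_liftedCut (h : IsPleatedPosition ι δ e) (cd : CollarData D) {R : ℝ} (hR : 2 + cd.h.κ / 2 < R)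
    (hRκ : R < 2 + cd.h.κ) : IsOpen (liftedCut D R) := by
  set G := proj5 ∘ ι ∘ e 0
  have hG : ContDiff ℝ ∞ G := contDiff_chartShadow h
  have hN : northPole ∉ range (liftedCrease ι (e 0)) := northPole_notMem_range_liftedCrease ι (e 0)
  -- the three open pieces: the chimney, the lifted OPEN cut collar, the open tube of height `t₀`
  set Ω : Set (EuclideanSpace ℝ (Fin 4)) := {u | 2 < ‖u‖ ∧ ‖u‖ < R}
  set T := D.τ '' (univ ×ˢ {w : EuclideanSpace ℝ (Fin 1) | |w 0| < cd.t₀})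
  have hΩo : IsOpen Ω :=
    (isOpen_lt continuous_const continuous_norm).inter (isOpen_lt continuous_norm continuous_const)
  have hVo : IsOpen {u : EuclideanSpace ℝ (Fin 4) | 2 < ‖u‖ ∧ ‖u‖ < 2 + cd.h.κ} :=
    (isOpen_lt continuous_const continuous_norm).inter (isOpen_lt continuous_norm continuous_const)
  -- the lifted open cut collar is open (inverse function theorem for `G`; `λ` is an open map)
  have hΩ' : IsOpen ((liftS4 ∘ G) '' Ω) := by
    rw [image_comp]
    exact isOpenMap_liftS4 _ (isOpen_image_of_injOn_fderiv hG.contDiffOn hVo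
      (fun x hx => cd.immersive x hx.1 hx.2) hΩo fun u hu => ⟨hu.1, hu.2.trans hRκ⟩)
  have hTo : IsOpen T := D.isOpenEmbedding.isOpenMap _ (isOpen_univ.prod
    (isOpen_lt (continuous_abs.comp ((EuclideanSpace.proj (0 : Fin 1)).continuous)) continuous_const))
  have hΩS : (liftS4 ∘ G) '' Ω ⊆ liftedCut D R := by
    rintro _ ⟨u, hu, rfl⟩
    exact Or.inr ⟨u, ⟨hu.1.le, hu.2⟩, rfl⟩
  have heq : liftedCut D R = (chimney D ∪ (liftS4 ∘ G) '' Ω) ∪ T := by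
    refine Subset.antisymm ?_
      (union_subset (union_subset subset_union_left hΩS) (image_tube_subset_liftedCut cd hR))
    rintro z (hz | ⟨u, hu, rfl⟩)
    · exact Or.inl (Or.inl hz)
    · rcases hu.1.lt_or_eq with hlt | heq
      · exact Or.inl (Or.inr ⟨u, ⟨hlt, hu.2⟩, rfl⟩)
      · -- a crease point lies in the core of the tube
        obtain ⟨x, hx⟩ : (liftS4 ∘ G) u ∈ range (liftedCrease ι (e 0)) := by
          rw [range_liftedCrease]
          exact ⟨u, mem_sphere_zero_iff_norm.2 heq.symm, rfl⟩
        refine Or.inr ⟨(x, 0), ⟨mem_univ _, ?_⟩, by rw [D.apply_zero, hx]⟩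
        show |(0 : EuclideanSpace ℝ (Fin 1)) 0| < cd.t₀
        simpa using cd.t₀_pos
  rw [heq]
  exact ((isOpen_chimney D hN).union hΩ').union hTo

/-- **The cut region is connected.** [folklore] -/
theorem isConnected_liftedCut (h : IsPleatedPosition ι δ e) (cd : CollarData D) {R : ℝ} (hR : 2 + cd.h.κ / 2 < R) :
    IsConnected (liftedCut D R) := by
  set G := proj5 ∘ ι ∘ e 0
  have hG : ContDiff ℝ ∞ G := contDiff_chartShadow h
  have hN : northPole ∉ range (liftedCrease ι (e 0)) := northPole_notMem_range_liftedCrease ι (e 0)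
  have hLG : Continuous (liftS4 ∘ G) := contMDiff_liftS4.continuous.comp hG.continuous
  have hR2 : 2 < R := by linarith [cd.h.pos]
  -- a crease point: in the lifted half-open collar and in the closure of the chimney
  set u₀ : EuclideanSpace ℝ (Fin 4) := EuclideanSpace.single (0 : Fin 4) (2 : ℝ)
  have hu₀ : ‖u₀‖ = 2 := by simp [u₀]
  have hz₀A : (liftS4 ∘ G) u₀ ∈ (liftS4 ∘ G) '' {u | 2 ≤ ‖u‖ ∧ ‖u‖ < R} :=
    ⟨u₀, ⟨hu₀.symm.le, by rw [hu₀]; exact hR2⟩, rfl⟩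
  have hz₀c : (liftS4 ∘ G) u₀ ∈ closure (chimney D) := by
    rw [closure_chimney D hN]
    refine le_of_eq ((sideσ_eq_zero_iff D hN _).2 ?_)
    rw [range_liftedCrease]
    exact ⟨u₀, mem_sphere_zero_iff_norm.2 hu₀, rfl⟩
  -- the chimney plus that point is preconnected (bark and tree) and meets the collar there
  have h1 : IsPreconnected (chimney D ∪ {(liftS4 ∘ G) u₀}) :=
    (isConnected_chimney D hN).isPreconnected.subset_closure subset_union_left
      (union_subset subset_closure (singleton_subset_iff.2 hz₀c))
  have h2 : IsPreconnected ((liftS4 ∘ G) '' {u | 2 ≤ ‖u‖ ∧ ‖u‖ < R}) :=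
    (isPreconnected_icoShell two_pos).image _ hLG.continuousOn
  have h3 : IsPreconnected (chimney D ∪ {(liftS4 ∘ G) u₀} ∪ (liftS4 ∘ G) '' {u | 2 ≤ ‖u‖ ∧ ‖u‖ < R}) :=
    h1.union' ⟨_, Or.inr rfl, hz₀A⟩ h2
  rw [union_assoc, union_eq_self_of_subset_left (singleton_subset_iff.2 hz₀A)] at h3
  exact ⟨⟨_, Or.inr hz₀A⟩, h3⟩

/-- The closure of the lifted half-open cut collar `λG({2 ≤ ‖u‖ < R})`, `2 < R`, is the
(compact) lifted CLOSED cut collar `λG({2 ≤ ‖u‖ ≤ R})`. -/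
theorem closure_image_icoShell (h : IsPleatedPosition ι δ e) {R : ℝ} (hR2 : 2 < R) :
    closure ((liftS4 ∘ proj5 ∘ ι ∘ e 0) '' {u | 2 ≤ ‖u‖ ∧ ‖u‖ < R}) =
      (liftS4 ∘ proj5 ∘ ι ∘ e 0) '' {u | 2 ≤ ‖u‖ ∧ ‖u‖ ≤ R} := by
  set G := proj5 ∘ ι ∘ e 0
  have hG : ContDiff ℝ ∞ G := contDiff_chartShadow h
  have hLG : Continuous (liftS4 ∘ G) := contMDiff_liftS4.continuous.comp hG.continuous
  have hKc : IsCompact ((liftS4 ∘ G) '' {u | 2 ≤ ‖u‖ ∧ ‖u‖ ≤ R}) :=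
    ((isCompact_closedBall (0 : EuclideanSpace ℝ (Fin 4)) R).of_isClosed_subset
      ((isClosed_le continuous_const continuous_norm).inter (isClosed_le continuous_norm continuous_const))
      fun u hu => mem_closedBall_zero_iff.2 hu.2).image hLG
  refine Subset.antisymm (closure_minimal (image_mono fun u hu => ⟨hu.1, hu.2.le⟩) hKc.isClosed) ?_
  rintro _ ⟨u, hu, rfl⟩
  rcases hu.2.lt_or_eq with hlt | heq
  · exact subset_closure ⟨u, ⟨hu.1, hlt⟩, rfl⟩
  · exact image_closure_subset_closure_image hLG ⟨u, mem_closure_icoShell hR2 heq, rfl⟩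

/-- **The exterior of the closure of the cut region** is the exterior minus the lifted CLOSED cut collar. [folklore] -/
theorem compl_closure_liftedCut (h : IsPleatedPosition ι δ e) (cd : CollarData D) {R : ℝ} (hR : 2 + cd.h.κ / 2 < R) :
    (closure (liftedCut D R))ᶜ = exterior D \ (liftS4 ∘ proj5 ∘ ι ∘ e 0) '' {u | 2 < ‖u‖ ∧ ‖u‖ ≤ R} := by
  have hN : northPole ∉ range (liftedCrease ι (e 0)) := northPole_notMem_range_liftedCrease ι (e 0)
  have hR2 : 2 < R := by linarith [cd.h.pos]
  rw [liftedCut, closure_union, closure_chimney D hN, closure_image_icoShell h hR2]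
  ext z
  simp only [mem_compl_iff, mem_union, mem_setOf_eq, not_or, not_le, Set.mem_sdiff, exterior]
  refine and_congr_right fun hz => not_congr ⟨?_, ?_⟩
  · rintro ⟨u, hu, rfl⟩
    rcases hu.1.lt_or_eq with hlt | heq
    · exact ⟨u, ⟨hlt, hu.2⟩, rfl⟩
    · -- a lifted shadow of radius `2` is a crease point, not exterior
      exfalso
      refine Set.disjoint_left.1 (disjoint_exterior_range D hN) hz ?_
      rw [range_liftedCrease]
      exact ⟨u, mem_sphere_zero_iff_norm.2 heq.symm, rfl⟩
  · rintro ⟨u, hu, rfl⟩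
    exact ⟨u, ⟨hu.1.le, hu.2⟩, rfl⟩

/-- **The frontier of the cut region** is the lifted sphere `λG(S_R)`. [folklore] -/
theorem frontier_liftedCut (h : IsPleatedPosition ι δ e) (cd : CollarData D) {R : ℝ} (hR : 2 + cd.h.κ / 2 < R)
    (hRκ : R < 2 + cd.h.κ) : frontier (liftedCut D R) = (liftS4 ∘ proj5 ∘ ι ∘ e 0) '' Metric.sphere 0 R := by
  have hR2 : 2 < R := by linarith [cd.h.pos]
  ext z
  -- `frontier U = closure U ∖ U`, and both complements are known
  have h1 := Set.ext_iff.1 (compl_liftedCut cd hR) z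
  have h2 := Set.ext_iff.1 (compl_closure_liftedCut h cd hR) z
  rw [mem_compl_iff] at h1 h2
  rw [(isOpen_liftedCut h cd hR hRκ).frontier_eq, Set.mem_sdiff]
  constructor
  · rintro ⟨hzcl, hzU⟩
    obtain ⟨hzE, hz1⟩ := h1.1 hzU
    have hz2 : z ∈ (liftS4 ∘ proj5 ∘ ι ∘ e 0) '' {u | 2 < ‖u‖ ∧ ‖u‖ ≤ R} := by
      by_contra hc
      exact h2.2 ⟨hzE, hc⟩ hzcl
    obtain ⟨u, hu, rfl⟩ := hz2
    rcases hu.2.lt_or_eq with hlt | heq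
    · exact absurd ⟨u, ⟨hu.1, hlt⟩, rfl⟩ hz1
    · exact ⟨u, mem_sphere_zero_iff_norm.2 heq, rfl⟩
  · rintro ⟨u, hu, rfl⟩
    have huR : ‖u‖ = R := mem_sphere_zero_iff_norm.1 hu
    have hu2 : 2 < ‖u‖ := by rw [huR]; exact hR2
    have huκ : ‖u‖ < 2 + cd.h.κ := by rw [huR]; exact hRκ
    refine ⟨?_, h1.2 ⟨cd.mem_exterior u hu2 huκ, ?_⟩⟩
    · -- in the closure: the lifted closed cut collar
      by_contra hc
      exact (h2.1 hc).2 ⟨u, ⟨hu2, huR.le⟩, rfl⟩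
    · -- not in the lifted open cut collar: thin-collar injectivity
      rintro ⟨u', ⟨hu'2, hu'R⟩, hu'eq⟩
      have hu'eq' : liftS4 ((proj5 ∘ ι ∘ e 0) u') = liftS4 ((proj5 ∘ ι ∘ e 0) u) := hu'eq
      have heq : u' = u :=
        cd.injOn ⟨hu'2.le, hu'R.trans hRκ⟩ ⟨hu2.le, huκ⟩ (liftS4_injective hu'eq')
      rw [heq, huR] at hu'R
      exact lt_irrefl _ hu'R

end CutRegion

end Summit.SmoothPoincare4.SmoothPoincare4.Theorems.OrigamiFoldExistence.ShadowPleats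

end
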